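import Literature.AnabelianGeometry.EtaleTheta.TemperedFrobenioidOfRankOneBase
import Literature.AnabelianGeometry.EtaleTheta.BiKummerOfModel
import Literature.AnabelianGeometry.EtaleTheta.Discharge.Sec5ConstantsDictionaryNoGoAtTowerCarriers
import HarnessLib

/-!
# [EtTh] Def. 3.6 (ii) / Def. 4.1: the rational functions `B(A)` and birational units `O^×(A^birat)` of the RANK-ONE ENGINE ARE the
# functions `B₀(F A)` of its Def. 3.3 (iii) datum — the dictionary `B(A) ≅ B₀(F A)` (class (b) construction)

S. Mochizuki, *The étale theta function …*, Publ. RIMS **45** (2009) [MochizukiEtTh2009], Def. 3.6 (ii) p.303 (PDF p.77): «Write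
`B := B₀^Λ|_D ×_{(Φ^{ℝ-log})^gp} Φ^gp → Φ^gp`.  Thus, the data `(D, Φ, B, B → Φ^gp)` determines a model Frobenioid `C`»; Def. 4.1 p.312 (PDF
p.86) (`O^×(A^birat)`); [FrdI] Thm. 5.2 (ii) p.101 («`O^×(−)` on `C^birat` is `B`»).  [cite: MochizukiEtTh2009, Def 3.6 (ii) p.303 (PDF p.77)]

abc-iut cell, layer L2, seat abc-iut-L2-d3 (gen 10); L2-lead ruling R1112 «CONST-DICT CARRIER = C^{bs-fld} HULL OVER THE GENUINE BASE»
(step (a) of the junction: identify the birational units of the hull with its constants `K_U^×`).  CLASS (b) CONSTRUCTION, GENERIC in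
abc-iut-w6-d048's engine `TemperedFrobenioid.ofRankOneBase hpf P hD hD' hFSM R S` (`TemperedFrobenioidOfRankOneBase.lean`; monoid type
`ℤ`, so `B₀^Λ = B₀`, Def. 3.6 (i)): for rank-one base data `P` over ANY Def. 3.3 (iii) datum `dm` and ANY object `A`,
* `toPfImage` — `Φ₀(F A) → Φ(A) = im(Φ₀^pf → Φ₀^rlf)`, `m ↦ [m]` (the natural map of Def. 3.6 (i), cod-restricted);
* **`ratFnOfBZero : B₀(F A) →* B(A)`, `b ↦ (b, [div₀ b])`** — well defined because `div_Λ = (Φ₀ → Φ₀^ℝ)^gp ∘ div₀` (Def. 3.6 (i) at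
  `Λ = ℤ`); its function component is `b` (`fst_ratFnOfBZero`); it is **bijective** (`ratFnOfBZero_bijective`: an element of `B(A)` is
  determined by its function component — abc-iut-L2-t11's `ratFn_ext_fst_weak` — and every `b` occurs), whence the isomorphism
  **`ratFnEquiv : B₀(F A) ≃* B(A)`** and, on units (every element of `B₀` being a unit, Def. 3.3 (iii)), **`biratUnitsEquiv :
  B₀(F A_D) ≃* O^×(A^birat) = B(A_D)^×`** for every object `A` of the engine's model Frobenioid (abc-iut-L2-t9's `biratUnitsModel`);
* `biratUnitsEquiv_symm_biratAutModel` — under this dictionary «the natural action» of `Aut_C(A)` on `O^×(A^birat)` (abc-iut-L2-t9's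
  `biratAutModel`, `= B(Base(σ⁻¹))`) is the pull-back `B₀(F(Base σ⁻¹))` of functions;
* `ratFnOfBZero_natural` — compatibility with pull-backs along morphisms of `D`.
USE (this lineage's base-field-theoretic hull, `TemperedFrobenioidOfBaseFieldHull.lean`, where `B₀(U) = Hom_Γ(Γ/U, ℚ̄_p^×) ≅ K_U^×`): the
birational units of every object of the hull over `Γ/U` are the constants `K_U^×` with their genuine Galois action — the carrier on which
the [EtTh] §5 constants dictionary is to be read.  HONEST FRAMING: bookkeeping over abc-iut-L2-t3's / w6-d048's / L2-t9's structures;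
nothing of [EtTh] is asserted; no instance, no notation, no `Prop`-valued definition, no sorry; nothing here bears on [IUTchIII] Cor. 3.12.
-/

noncomputable section

namespace Literature.AnabelianGeometry.EtaleTheta

open CategoryTheory Opposite Function Literature.AlgebraicGeometry.Frobenioids

universe u₀ v₀ w u v

namespace TemperedFrobenioid

namespace RankOneBase

variable {D₀ : Type u₀} [Category.{v₀} D₀] {dm : DivisorMonoids.{u₀, v₀, w} D₀}
  (hpf : ∀ Y : D₀ᵒᵖ, IsPerfFactorialCof (dm.Φ₀.obj Y)) {D : Type u} [Category.{v} D] (P : RankOneBase dm D)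
  (hD : IsConnected D) (hD' : IsTotallyEpimorphic D) (hFSM : IsOfFSMType D) (R S : (Dᵒᵖ ⥤ CommMonCat.{w}) → Prop)

/-- **`Φ₀(F A) → Φ(A) = im(Φ₀^pf → Φ₀^rlf)`**, `m ↦ [m]` — the natural map `Φ₀ → Φ₀^pf → Φ₀^rlf` of Def. 3.6 (i), cod-restricted to the
engine's divisor monoid `Φ(A)`. [cite: MochizukiEtTh2009, Def 3.6 (i) p.302 (PDF p.76)] -/
def toPfImage (A : Dᵒᵖ) : dm.Φ₀.obj (op (P.F.obj A.unop)) →* P.pfImage hpf A :=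
  ((hpf (op (P.F.obj A.unop))).weak.toRealification.mrangeRestrict).comp (Perfection.of _)

/-- `[m]` read in `Φ₀^ℝ(F A)` is the Def. 3.6 (i) map `toR`. [cite: MochizukiEtTh2009, Def 3.6 (i) p.302 (PDF p.76)] -/
theorem coe_toPfImage (A : Dᵒᵖ) (m : dm.Φ₀.obj (op (P.F.obj A.unop))) :
    ((toPfImage hpf P A m : P.pfImage hpf A) : (RealifiedDivisorMonoids.ofRlfZWeak dm hpf).ΦR.obj (op (P.F.obj A.unop))) =
      (RealifiedDivisorMonoids.ofRlfZWeak dm hpf).toR (op (P.F.obj A.unop)) m := rfl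

/-- The inclusion `Φ(A) ⊆ Φ^{ℝ-log}(A)` after `toPfImage` is `toR` (as homomorphisms). [cite: MochizukiEtTh2009, Def 3.6 (i) p.302 (PDF p.76)] -/
theorem subtype_comp_toPfImage (A : Dᵒᵖ) :
    (P.pfImage hpf A).subtype.comp (toPfImage hpf P A) = (RealifiedDivisorMonoids.ofRlfZWeak dm hpf).toR (op (P.F.obj A.unop)) :=
  MonoidHom.ext fun _ => rfl

/-- **`B₀(F A) → B(A)`, `b ↦ (b, [div₀ b])`**: a function of the Def. 3.3 (iii) datum IS a rational function of the engine (`B = B₀ ×_{(Φ^{ℝ-log})^gp} Φ^gp`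
with `div_Λ = toR^gp ∘ div₀` at monoid type `ℤ`).  [cite: MochizukiEtTh2009, Def 3.6 (ii) p.303 (PDF p.77)] -/
def ratFnOfBZero (A : Dᵒᵖ) : dm.B₀.obj (op (P.F.obj A.unop)) →* (ofRankOneBase hpf P hD hD' hFSM R S).ratFn A where
  toFun b := ⟨(b, gpMap (toPfImage hpf P A) (dm.div₀ _ b)), by
    change (RealifiedDivisorMonoids.ofRlfZWeak dm hpf).divΛ (op (P.F.obj A.unop)) b =
      (ofRankOneBase hpf P hD hD' hFSM R S).ΦgpToRlog A (gpMap (toPfImage hpf P A) (dm.div₀ _ b))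
    change gpMap ((RealifiedDivisorMonoids.ofRlfZWeak dm hpf).toR (op (P.F.obj A.unop))) (dm.div₀ _ b) =
      gpMap (P.pfImage hpf A).subtype (gpMap (toPfImage hpf P A) (dm.div₀ _ b))
    rw [← subtype_comp_toPfImage hpf P A]
    exact gpMap_comp_apply'' _ _ _⟩
  map_one' := Subtype.ext (Prod.ext rfl
    (show gpMap (toPfImage hpf P A) (dm.div₀ _ 1) = 1 by rw [map_one, map_one]))
  map_mul' b c := Subtype.ext (Prod.ext rfl
    (show gpMap (toPfImage hpf P A) (dm.div₀ _ (b * c)) =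
        gpMap (toPfImage hpf P A) (dm.div₀ _ b) * gpMap (toPfImage hpf P A) (dm.div₀ _ c) by rw [map_mul, map_mul]))

/-- The function component of `ratFnOfBZero b` is `b`. [cite: MochizukiEtTh2009, Def 3.6 (ii) p.303 (PDF p.77)] -/
@[simp] theorem fst_ratFnOfBZero (A : Dᵒᵖ) (b : dm.B₀.obj (op (P.F.obj A.unop))) :
    (ratFnOfBZero hpf P hD hD' hFSM R S A b).1.1 = b := rfl

/-- The divisor component of `ratFnOfBZero b` is `[div₀ b]`. [cite: MochizukiEtTh2009, Def 3.6 (ii) p.303 (PDF p.77)] -/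
theorem snd_ratFnOfBZero (A : Dᵒᵖ) (b : dm.B₀.obj (op (P.F.obj A.unop))) :
    (ratFnOfBZero hpf P hD hD' hFSM R S A b).1.2 = gpMap (toPfImage hpf P A) (dm.div₀ _ b) := rfl

/-- **`ratFnOfBZero` is bijective** (injective on the function component; surjective because an element of `B(A)` is determined by its
function component — abc-iut-L2-t11's `ratFn_ext_fst_weak`). [cite: MochizukiEtTh2009, Def 3.6 (ii) p.303 (PDF p.77)] -/
theorem ratFnOfBZero_bijective (A : Dᵒᵖ) : Bijective (ratFnOfBZero hpf P hD hD' hFSM R S A) := by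
  refine ⟨fun b c h => ?_, fun q => ⟨q.1.1, ?_⟩⟩
  · have := congrArg (fun q : (ofRankOneBase hpf P hD hD' hFSM R S).ratFn A => q.1.1) h
    exact this
  · exact (ofRankOneBase hpf P hD hD' hFSM R S).ratFn_ext_fst_weak A rfl

/-- **`B₀(F A) ≅ B(A)`.** [cite: MochizukiEtTh2009, Def 3.6 (ii) p.303 (PDF p.77)] -/
def ratFnEquiv (A : Dᵒᵖ) : dm.B₀.obj (op (P.F.obj A.unop)) ≃* (ofRankOneBase hpf P hD hD' hFSM R S).ratFn A :=
  MulEquiv.ofBijective (ratFnOfBZero hpf P hD hD' hFSM R S A) (ratFnOfBZero_bijective hpf P hD hD' hFSM R S A)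

/-- `ratFnEquiv` is `ratFnOfBZero`. [cite: MochizukiEtTh2009, Def 3.6 (ii) p.303 (PDF p.77)] -/
@[simp] theorem ratFnEquiv_apply (A : Dᵒᵖ) (b : dm.B₀.obj (op (P.F.obj A.unop))) :
    ratFnEquiv hpf P hD hD' hFSM R S A b = ratFnOfBZero hpf P hD hD' hFSM R S A b := rfl

/-- The inverse reads off the function component. [cite: MochizukiEtTh2009, Def 3.6 (ii) p.303 (PDF p.77)] -/
theorem ratFnEquiv_symm_apply (A : Dᵒᵖ) (q : (ofRankOneBase hpf P hD hD' hFSM R S).ratFn A) :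
    (ratFnEquiv hpf P hD hD' hFSM R S A).symm q = q.1.1 := by
  apply (ratFnEquiv hpf P hD hD' hFSM R S A).injective
  rw [MulEquiv.apply_symm_apply, ratFnEquiv_apply]
  exact (ofRankOneBase hpf P hD hD' hFSM R S).ratFn_ext_fst_weak A rfl

/-- **Naturality**: pulling back `(b, [div₀ b])` along `f : A' → A` in `D` gives `(B₀(F f) b, [div₀ (B₀(F f) b)])`.
[cite: MochizukiEtTh2009, Def 3.6 (ii) p.303 (PDF p.77)] -/
theorem ratFnOfBZero_natural {A A' : Dᵒᵖ} (f : A ⟶ A') (b : dm.B₀.obj (op (P.F.obj A.unop))) :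
    (ofRankOneBase hpf P hD hD' hFSM R S).ratFnPull f (ratFnOfBZero hpf P hD hD' hFSM R S A b) =
      ratFnOfBZero hpf P hD hD' hFSM R S A' ((dm.B₀.map (P.F.map f.unop).op).hom b) :=
  (ofRankOneBase hpf P hD hD' hFSM R S).ratFn_ext_fst_weak A' rfl

/-! ## Birational units of an object of the engine's model Frobenioid -/

/-- Every function of the Def. 3.3 (iii) datum is a unit (`B₀` is a group of functions). [cite: MochizukiEtTh2009, Def 3.3 (iii) p.299 (PDF p.73)] -/
theorem isUnit_bZero (Y : D₀ᵒᵖ) (b : dm.B₀.obj Y) : IsUnit b := dm.isUnit_B₀ Y b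

/-- Every rational function of the engine is a unit (`B` is group-like, Def. 3.6 (i)/(ii); abc-iut-L2-t9's `isUnit_ratFn`).
[cite: MochizukiEtTh2009, Def 3.6 (ii) p.303 (PDF p.77)] -/
theorem isUnit_ratFnOfBZero (A : Dᵒᵖ) (b : dm.B₀.obj (op (P.F.obj A.unop))) : IsUnit (ratFnOfBZero hpf P hD hD' hFSM R S A b) :=
  (ofRankOneBase hpf P hD hD' hFSM R S).isUnit_ratFn (fun b' => dm.isUnit_B₀ _ b') _

/-- **`B₀(F A_D) → O^×(A^birat) = B(A_D)^×`** for an object `A` of the engine's model Frobenioid: `b ↦` the unit `(b, [div₀ b])`.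
[cite: MochizukiEtTh2009, Def 4.1 p.312 (PDF p.86)] -/
def biratUnitsOfBZero (A : (ofRankOneBase hpf P hD hD' hFSM R S).category) :
    dm.B₀.obj (op (P.F.obj A.base)) →* (ofRankOneBase hpf P hD hD' hFSM R S).biratUnitsModel A :=
  IsUnit.liftRight (ratFnOfBZero hpf P hD hD' hFSM R S (op A.base)) (isUnit_ratFnOfBZero hpf P hD hD' hFSM R S (op A.base))

/-- The underlying rational function of `biratUnitsOfBZero b` is `(b, [div₀ b])`. [cite: MochizukiEtTh2009, Def 4.1 p.312 (PDF p.86)] -/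
@[simp] theorem coe_biratUnitsOfBZero (A : (ofRankOneBase hpf P hD hD' hFSM R S).category) (b : dm.B₀.obj (op (P.F.obj A.base))) :
    ((biratUnitsOfBZero hpf P hD hD' hFSM R S A b : (ofRankOneBase hpf P hD hD' hFSM R S).biratUnitsModel A) :
      (ofRankOneBase hpf P hD hD' hFSM R S).ratFnFunctor.obj (op A.base)) = ratFnOfBZero hpf P hD hD' hFSM R S (op A.base) b :=
  IsUnit.coe_liftRight _ (isUnit_ratFnOfBZero hpf P hD hD' hFSM R S (op A.base)) b

/-- **`biratUnitsOfBZero` is bijective**: `O^×(A^birat) ≅ B₀(F A_D)`. [cite: MochizukiEtTh2009, Def 4.1 p.312 (PDF p.86)] -/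
theorem biratUnitsOfBZero_bijective (A : (ofRankOneBase hpf P hD hD' hFSM R S).category) :
    Bijective (biratUnitsOfBZero hpf P hD hD' hFSM R S A) := by
  refine ⟨fun b c h => ?_, fun u => ?_⟩
  · have h1 := congrArg (fun u : (ofRankOneBase hpf P hD hD' hFSM R S).biratUnitsModel A =>
      ((u : (ofRankOneBase hpf P hD hD' hFSM R S).ratFnFunctor.obj (op A.base)) :
        (ofRankOneBase hpf P hD hD' hFSM R S).ratFn (op A.base)).1.1) h
    simp only [coe_biratUnitsOfBZero] at h1
    exact h1
  · refine ⟨((u : (ofRankOneBase hpf P hD hD' hFSM R S).ratFnFunctor.obj (op A.base)) :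
      (ofRankOneBase hpf P hD hD' hFSM R S).ratFn (op A.base)).1.1, Units.ext ?_⟩
    rw [coe_biratUnitsOfBZero]
    exact (ofRankOneBase hpf P hD hD' hFSM R S).ratFn_ext_fst_weak (op A.base) rfl

/-- **`O^×(A^birat) ≅ B₀(F A_D)`** — the birational units of an object of the engine are the functions of its Def. 3.3 (iii) datum.
[cite: MochizukiEtTh2009, Def 4.1 p.312 (PDF p.86)] -/
def biratUnitsEquiv (A : (ofRankOneBase hpf P hD hD' hFSM R S).category) :
    dm.B₀.obj (op (P.F.obj A.base)) ≃* (ofRankOneBase hpf P hD hD' hFSM R S).biratUnitsModel A :=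
  MulEquiv.ofBijective (biratUnitsOfBZero hpf P hD hD' hFSM R S A) (biratUnitsOfBZero_bijective hpf P hD hD' hFSM R S A)

/-- `biratUnitsEquiv` is `biratUnitsOfBZero`. [cite: MochizukiEtTh2009, Def 4.1 p.312 (PDF p.86)] -/
@[simp] theorem biratUnitsEquiv_apply (A : (ofRankOneBase hpf P hD hD' hFSM R S).category) (b : dm.B₀.obj (op (P.F.obj A.base))) :
    biratUnitsEquiv hpf P hD hD' hFSM R S A b = biratUnitsOfBZero hpf P hD hD' hFSM R S A b := rfl

/-- The inverse dictionary reads the function component. [cite: MochizukiEtTh2009, Def 4.1 p.312 (PDF p.86)] -/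
theorem biratUnitsEquiv_symm_apply (A : (ofRankOneBase hpf P hD hD' hFSM R S).category)
    (u : (ofRankOneBase hpf P hD hD' hFSM R S).biratUnitsModel A) :
    (biratUnitsEquiv hpf P hD hD' hFSM R S A).symm u =
      ((u : (ofRankOneBase hpf P hD hD' hFSM R S).ratFnFunctor.obj (op A.base)) :
        (ofRankOneBase hpf P hD hD' hFSM R S).ratFn (op A.base)).1.1 := by
  apply (biratUnitsEquiv hpf P hD hD' hFSM R S A).injective
  rw [MulEquiv.apply_symm_apply, biratUnitsEquiv_apply]
  apply Units.ext
  rw [coe_biratUnitsOfBZero]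
  exact (ofRankOneBase hpf P hD hD' hFSM R S).ratFn_ext_fst_weak (op A.base) rfl

/-- **«The natural action» of `Aut_C(A)` on `O^×(A^birat)` IS the pull-back of functions**: under the dictionary, `σ · f` has function
component `B₀(F(Base σ⁻¹))(f)` (abc-iut-L2-t9's `coe_biratAutModel_apply`). [cite: MochizukiEtTh2009, Def 4.1 p.313 (PDF p.87)] -/
theorem biratUnitsEquiv_symm_biratAutModel (A : (ofRankOneBase hpf P hD hD' hFSM R S).category) (σ : Aut A)
    (u : (ofRankOneBase hpf P hD hD' hFSM R S).biratUnitsModel A) :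
    (biratUnitsEquiv hpf P hD hD' hFSM R S A).symm ((ofRankOneBase hpf P hD hD' hFSM R S).biratAutModel A σ u) =
      (dm.B₀.map (P.F.map (ModelFrobenioid.baseMap σ.inv)).op).hom ((biratUnitsEquiv hpf P hD hD' hFSM R S A).symm u) := by
  rw [biratUnitsEquiv_symm_apply, biratUnitsEquiv_symm_apply, coe_biratAutModel_apply]
  rfl

end RankOneBase

end TemperedFrobenioid

end Literature.AnabelianGeometry.EtaleTheta

end
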